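import Mathlib.Algebra.Group.Subgroup.Lattice
import Mathlib.Algebra.Ring.Subring.Basic
import Mathlib.Algebra.Order.Floor.Defs
import Mathlib.Tactic.FieldSimp
import Mathlib.Tactic.GCongr
import Mathlib.Tactic.Linarith
import Mathlib.Tactic.NormNum
import Mathlib.Tactic.Positivity
import Mathlib.Tactic.Ring
import Literature.Computability.Complexity.ElementaryRecursive
import HarnessLib

/-!
# Elementary real numbers form an additive group containing `ℚ` (Yoshinaga 2008, Prop. 10)

`Literature.Computability.Complexity.IsElementaryReal x` (file `ComputableReal.lean`) says that the
real number `x` is *elementary* in the sense of Yoshinaga, *Periods and elementary real numbers*,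
arXiv:0805.0349 (2008), Def. 9, in the three-sequence form of Tent–Ziegler, Münster J. Math. 3
(2010), Def. 2.4: there are Kalmár elementary `a b c : ℕ → ℕ` with
`|x - (a n - b n)/(c n + 1)| ≤ 1/(n+1)` for every `n`.

Yoshinaga, Prop. 10 ("straightforward", no proof printed): *the set `ℝ_elem` of elementary real
numbers forms a field*; Tent–Ziegler 2010, Cor. 4.5 (Skordev): it is even a real closed field. This
file proves the part of Prop. 10 used in the proof of Yoshinaga's main theorem (Thm. 18, real
periods are elementary, which concludes from "`vol(D) ∈ ℝ_elem`" for finitely many bounded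
semialgebraic `D` by taking `ℤ`-linear combinations): the elementary reals contain `ℚ` and are
closed under `0`, negation, addition, subtraction, finite sums, hence contain the additive subgroup
generated by any set of elementary reals (`IsElementaryReal.closure_induction'`).  It also records
the normal form in which such numbers arise in §3.4–3.6 of the paper: a real number approximated by
elementary fractions `p N / q N` to within `E / N` is elementary (`IsElementaryReal.of_nat_approx`,
the passage "`4 r L √ℓ k < n ⟹ |vol(D) - vol(V_n)| < 1/k`" of Lemma 29 to Def. 9).  A second
section adds closure under multiplication (`IsElementaryReal.mul`), so that the elementary reals
form a subring of `ℝ` and contain the subring generated by any set of elementary reals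
(`IsElementaryReal.of_mem_subringClosure`).

Proofs: for the sum, read both names along the elementary reindexing `n ↦ 2n + 1` (error
`2 · 1/(2n+2) = 1/(n+1)`) and bring to the common denominator `(c+1)(c'+1)`; all sequence
manipulations stay inside `ElementaryRec` by the closure API of `ElementaryRecursive.lean`.
Everything here is a proved theorem; no definitions and no named facts are introduced.

## References

* M. Yoshinaga, *Periods and elementary real numbers*, arXiv:0805.0349 (2008), Def. 9, Prop. 10,
  Lemma 29.
* K. Tent, M. Ziegler, *Computable functions of reals*, Münster J. Math. 3 (2010), Def. 2.4,
  Cor. 4.5.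
-/

namespace Literature.Computability.Complexity

namespace IsElementaryReal

/-- `0` is an elementary real (all three sequences zero). [cite: Yoshinaga2008, Prop. 10] -/
protected theorem zero : IsElementaryReal 0 :=
  ⟨fun _ => 0, fun _ => 0, fun _ => 0, ElementaryRec.zero, ElementaryRec.zero, ElementaryRec.zero,
    fun n => by simp only [Nat.cast_zero, sub_self, zero_add, div_one, abs_zero]; positivity⟩

/-- Every rational number is an elementary real: `q = (num⁺ - num⁻)/((den - 1) + 1)` with constant
sequences (Yoshinaga 2008, Example 3 (1): `ℝ_const = ℚ`). [cite: Yoshinaga2008, Example 3 (1)] -/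
protected theorem ratCast (q : ℚ) : IsElementaryReal (q : ℝ) := by
  refine ⟨fun _ => q.num.toNat, fun _ => (-q.num).toNat, fun _ => q.den - 1, ElementaryRec.const _,
    ElementaryRec.const _, ElementaryRec.const _, fun n => ?_⟩
  have hden : ((q.den - 1 : ℕ) : ℝ) + 1 = q.den := by
    rw [Nat.cast_sub q.den_pos, Nat.cast_one, sub_add_cancel]
  have hnum : ((q.num.toNat : ℕ) : ℝ) - ((-q.num).toNat : ℕ) = q.num := by
    have h : ((q.num.toNat : ℤ) - ((-q.num).toNat : ℤ)) = q.num := Int.toNat_sub_toNat_neg q.num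
    exact_mod_cast h
  rw [hden, hnum]
  have hq : (q : ℝ) = (q.num : ℝ) / (q.den : ℝ) := by exact_mod_cast (Rat.num_div_den q).symm
  rw [← hq, sub_self, abs_zero]
  positivity

/-- Every natural number is an elementary real. [cite: Yoshinaga2008, Example 3 (1)] -/
protected theorem natCast (k : ℕ) : IsElementaryReal (k : ℝ) := by
  simpa using IsElementaryReal.ratCast k

/-- Every integer is an elementary real. [cite: Yoshinaga2008, Example 3 (1)] -/
protected theorem intCast (k : ℤ) : IsElementaryReal (k : ℝ) := by
  simpa using IsElementaryReal.ratCast k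

/-- Elementary reals are closed under negation (swap the two numerator sequences).
[cite: Yoshinaga2008, Prop. 10] -/
protected theorem neg {x : ℝ} (hx : IsElementaryReal x) : IsElementaryReal (-x) := by
  obtain ⟨a, b, c, ha, hb, hc, h⟩ := hx
  refine ⟨b, a, c, hb, ha, hc, fun n => ?_⟩
  rw [← abs_neg]
  convert h n using 2
  ring

/-- The reindexing `n ↦ 2 n + 1` is elementary. [folklore] -/
theorem elementaryRec_two_mul_add_one : ElementaryRec fun n => 2 * n + 1 :=
  ElementaryRec.succ' (ElementaryRec.mul' (ElementaryRec.const 2) ElementaryRec.id')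

/-- Elementary reals are closed under addition: read both names at index `2n + 1` and add the
fractions over the common denominator `(c + 1)(c' + 1)`. [cite: Yoshinaga2008, Prop. 10] -/
protected theorem add {x y : ℝ} (hx : IsElementaryReal x) (hy : IsElementaryReal y) :
    IsElementaryReal (x + y) := by
  obtain ⟨a, b, c, ha, hb, hc, h⟩ := hx
  obtain ⟨a', b', c', ha', hb', hc', h'⟩ := hy
  set φ : ℕ → ℕ := fun n => 2 * n + 1 with hφ
  have eφ : ElementaryRec φ := elementaryRec_two_mul_add_one
  refine ⟨fun n => a (φ n) * (c' (φ n) + 1) + a' (φ n) * (c (φ n) + 1),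
    fun n => b (φ n) * (c' (φ n) + 1) + b' (φ n) * (c (φ n) + 1),
    fun n => (c (φ n) + 1) * (c' (φ n) + 1) - 1, ?_, ?_, ?_, fun n => ?_⟩
  · exact ElementaryRec.add' (ElementaryRec.mul' (ha.comp eφ) (ElementaryRec.succ' (hc'.comp eφ)))
      (ElementaryRec.mul' (ha'.comp eφ) (ElementaryRec.succ' (hc.comp eφ)))
  · exact ElementaryRec.add' (ElementaryRec.mul' (hb.comp eφ) (ElementaryRec.succ' (hc'.comp eφ)))
      (ElementaryRec.mul' (hb'.comp eφ) (ElementaryRec.succ' (hc.comp eφ)))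
  · exact ElementaryRec.tsub' (ElementaryRec.mul' (ElementaryRec.succ' (hc.comp eφ))
      (ElementaryRec.succ' (hc'.comp eφ))) (ElementaryRec.const 1)
  · have hC : (((c (φ n) + 1) * (c' (φ n) + 1) - 1 : ℕ) : ℝ) + 1 =
        ((c (φ n) : ℝ) + 1) * ((c' (φ n) : ℝ) + 1) := by
      have h1 : 1 ≤ (c (φ n) + 1) * (c' (φ n) + 1) := Nat.one_le_iff_ne_zero.2 (by positivity)
      rw [Nat.cast_sub h1]
      push_cast
      ring
    have hpos : (0 : ℝ) < (c (φ n) : ℝ) + 1 := by positivity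
    have hpos' : (0 : ℝ) < (c' (φ n) : ℝ) + 1 := by positivity
    have key : (((a (φ n) * (c' (φ n) + 1) + a' (φ n) * (c (φ n) + 1) : ℕ) : ℝ) -
          ((b (φ n) * (c' (φ n) + 1) + b' (φ n) * (c (φ n) + 1) : ℕ) : ℝ)) /
          ((((c (φ n) + 1) * (c' (φ n) + 1) - 1 : ℕ) : ℝ) + 1) =
        ((a (φ n) : ℝ) - b (φ n)) / ((c (φ n) : ℝ) + 1) +
          ((a' (φ n) : ℝ) - b' (φ n)) / ((c' (φ n) : ℝ) + 1) := by
      rw [hC]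
      push_cast
      field_simp
      ring
    rw [key]
    have hn : (1 : ℝ) / ((φ n : ℕ) + 1) + 1 / ((φ n : ℕ) + 1) = 1 / ((n : ℝ) + 1) := by
      simp only [hφ]
      push_cast
      have : (n : ℝ) + 1 ≠ 0 := by positivity
      field_simp
      ring
    calc |x + y - (((a (φ n) : ℝ) - b (φ n)) / ((c (φ n) : ℝ) + 1) +
            ((a' (φ n) : ℝ) - b' (φ n)) / ((c' (φ n) : ℝ) + 1))|
        = |(x - ((a (φ n) : ℝ) - b (φ n)) / ((c (φ n) : ℝ) + 1)) +
            (y - ((a' (φ n) : ℝ) - b' (φ n)) / ((c' (φ n) : ℝ) + 1))| := by ring_nf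
      _ ≤ |x - ((a (φ n) : ℝ) - b (φ n)) / ((c (φ n) : ℝ) + 1)| +
            |y - ((a' (φ n) : ℝ) - b' (φ n)) / ((c' (φ n) : ℝ) + 1)| := abs_add_le _ _
      _ ≤ 1 / ((φ n : ℕ) + 1) + 1 / ((φ n : ℕ) + 1) := add_le_add (h _) (h' _)
      _ = 1 / ((n : ℝ) + 1) := hn

/-- Elementary reals are closed under subtraction. [cite: Yoshinaga2008, Prop. 10] -/
protected theorem sub {x y : ℝ} (hx : IsElementaryReal x) (hy : IsElementaryReal y) :
    IsElementaryReal (x - y) := by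
  simpa [sub_eq_add_neg] using hx.add hy.neg

/-- Finite sums of elementary reals are elementary. [cite: Yoshinaga2008, Prop. 10] -/
protected theorem sum {ι : Type*} (s : Finset ι) {f : ι → ℝ} (hf : ∀ i ∈ s, IsElementaryReal (f i)) :
    IsElementaryReal (∑ i ∈ s, f i) := by
  classical
  induction s using Finset.induction_on with
  | empty => simpa using IsElementaryReal.zero
  | insert i s hi ih =>
    rw [Finset.sum_insert hi]
    exact (hf i (Finset.mem_insert_self i s)).add (ih fun j hj => hf j (Finset.mem_insert_of_mem hj))

/-- Integer multiples of elementary reals are elementary. [cite: Yoshinaga2008, Prop. 10] -/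
protected theorem int_mul {x : ℝ} (k : ℤ) (hx : IsElementaryReal x) :
    IsElementaryReal ((k : ℝ) * x) := by
  induction k using Int.induction_on with
  | zero => simpa using IsElementaryReal.zero
  | succ k ih =>
    have h := ih.add hx
    convert h using 1
    push_cast
    ring
  | pred k ih =>
    have h := ih.sub hx
    convert h using 1
    push_cast
    ring

/-- The additive subgroup of `ℝ` generated by a set of elementary reals consists of elementary
reals (the elementary reals form an additive subgroup of `ℝ`; Yoshinaga 2008, Prop. 10: a field).
This is the form in which Prop. 10 enters the proof of Thm. 18 ("periods are generated by volumes
of bounded semialgebraic sets", Lemma 24). [cite: Yoshinaga2008, Prop. 10] -/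
theorem of_mem_addSubgroupClosure {s : Set ℝ} (hs : ∀ y ∈ s, IsElementaryReal y) {x : ℝ}
    (hx : x ∈ AddSubgroup.closure s) : IsElementaryReal x := by
  induction hx using AddSubgroup.closure_induction with
  | mem y hy => exact hs y hy
  | zero => exact IsElementaryReal.zero
  | add y z _ _ hy hz => exact hy.add hz
  | neg y _ hy => exact hy.neg

/-! ### Elementary reals from elementary fractions with an explicit rate -/

/-- **Normal form of §3.4–3.6.** If a real number `x` is approximated by fractions of elementary
functions, `|x - p N / q N| ≤ E / N` for all `N ≥ 1` with `q N ≥ 1`, then `x` is an elementary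
real: read the fraction at `N = (E + 1)(n + 1)`, where the error is `≤ 1/(n+1)` (this is the step
"if `4 r L √ℓ k < n` then `|vol(D) - vol(V_n)| < 1/k`, hence `vol(D) ∈ ℝ_elem`" of Yoshinaga 2008,
Lemma 29 with Def. 9 / Lemma 12). [cite: Yoshinaga2008, Lemma 29] -/
theorem of_nat_approx {x : ℝ} (p q : ℕ → ℕ) (E : ℕ) (hp : ElementaryRec p) (hq : ElementaryRec q)
    (hq1 : ∀ N, 1 ≤ N → 1 ≤ q N)
    (h : ∀ N : ℕ, 1 ≤ N → |x - (p N : ℝ) / (q N : ℝ)| ≤ (E : ℝ) / N) : IsElementaryReal x := by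
  set ψ : ℕ → ℕ := fun n => (E + 1) * (n + 1) with hψ
  have eψ : ElementaryRec ψ :=
    ElementaryRec.mul' (ElementaryRec.const _) (ElementaryRec.succ' ElementaryRec.id')
  have hψ1 : ∀ n, 1 ≤ ψ n := fun n => Nat.one_le_iff_ne_zero.2 (by positivity)
  refine ⟨fun n => p (ψ n), fun _ => 0, fun n => q (ψ n) - 1, hp.comp eψ, ElementaryRec.zero,
    ElementaryRec.tsub' (hq.comp eψ) (ElementaryRec.const 1), fun n => ?_⟩
  have hqψ : ((q (ψ n) - 1 : ℕ) : ℝ) + 1 = q (ψ n) := by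
    rw [Nat.cast_sub (hq1 _ (hψ1 n)), Nat.cast_one, sub_add_cancel]
  rw [hqψ, Nat.cast_zero, sub_zero]
  refine (h (ψ n) (hψ1 n)).trans ?_
  have hE : (0 : ℝ) ≤ E := Nat.cast_nonneg E
  have hn : (0 : ℝ) < (n : ℝ) + 1 := by positivity
  rw [div_le_div_iff₀ (by exact_mod_cast hψ1 n) hn, hψ]
  push_cast
  nlinarith

/-- Signed variant of `IsElementaryReal.of_nat_approx`: fractions `(p N - p' N) / q N`.
[cite: Yoshinaga2008, Lemma 29] -/
theorem of_nat_approx_sub {x : ℝ} (p p' q : ℕ → ℕ) (E : ℕ) (hp : ElementaryRec p)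
    (hp' : ElementaryRec p') (hq : ElementaryRec q) (hq1 : ∀ N, 1 ≤ N → 1 ≤ q N)
    (h : ∀ N : ℕ, 1 ≤ N → |x - ((p N : ℝ) - p' N) / (q N : ℝ)| ≤ (E : ℝ) / N) :
    IsElementaryReal x := by
  set ψ : ℕ → ℕ := fun n => (E + 1) * (n + 1) with hψ
  have eψ : ElementaryRec ψ :=
    ElementaryRec.mul' (ElementaryRec.const _) (ElementaryRec.succ' ElementaryRec.id')
  have hψ1 : ∀ n, 1 ≤ ψ n := fun n => Nat.one_le_iff_ne_zero.2 (by positivity)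
  refine ⟨fun n => p (ψ n), fun n => p' (ψ n), fun n => q (ψ n) - 1, hp.comp eψ, hp'.comp eψ,
    ElementaryRec.tsub' (hq.comp eψ) (ElementaryRec.const 1), fun n => ?_⟩
  have hqψ : ((q (ψ n) - 1 : ℕ) : ℝ) + 1 = q (ψ n) := by
    rw [Nat.cast_sub (hq1 _ (hψ1 n)), Nat.cast_one, sub_add_cancel]
  rw [hqψ]
  refine (h (ψ n) (hψ1 n)).trans ?_
  have hE : (0 : ℝ) ≤ E := Nat.cast_nonneg E
  have hn : (0 : ℝ) < (n : ℝ) + 1 := by positivity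
  rw [div_le_div_iff₀ (by exact_mod_cast hψ1 n) hn, hψ]
  push_cast
  nlinarith

end IsElementaryReal

/-! ### Multiplication (Yoshinaga 2008, Prop. 10: `ℝ_elem` is a field — the ring part) -/

namespace IsElementaryReal

/-- An elementary real is bounded by its first approximation: `|x| ≤ a 0 + b 0 + 1`. [folklore] -/
theorem abs_le_of_approx {x : ℝ} {a b c : ℕ → ℕ}
    (h : ∀ n : ℕ, |x - ((a n : ℝ) - b n) / ((c n : ℝ) + 1)| ≤ 1 / ((n : ℝ) + 1)) :
    |x| ≤ (a 0 : ℝ) + b 0 + 1 := by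
  have h0 := h 0
  simp only [Nat.cast_zero, zero_add, div_one] at h0
  have hc : (1 : ℝ) ≤ (c 0 : ℝ) + 1 := by simp
  have hfrac : |((a 0 : ℝ) - b 0) / ((c 0 : ℝ) + 1)| ≤ (a 0 : ℝ) + b 0 := by
    rw [abs_div, abs_of_pos (by positivity : (0 : ℝ) < (c 0 : ℝ) + 1), div_le_iff₀ (by positivity)]
    calc |(a 0 : ℝ) - b 0| ≤ |(a 0 : ℝ)| + |(b 0 : ℝ)| := abs_sub _ _
      _ = (a 0 : ℝ) + b 0 := by rw [Nat.abs_cast, Nat.abs_cast]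
      _ ≤ ((a 0 : ℝ) + b 0) * ((c 0 : ℝ) + 1) := le_mul_of_one_le_right (by positivity) hc
  calc |x| = |(x - ((a 0 : ℝ) - b 0) / ((c 0 : ℝ) + 1)) + ((a 0 : ℝ) - b 0) / ((c 0 : ℝ) + 1)| := by
        ring_nf
    _ ≤ |x - ((a 0 : ℝ) - b 0) / ((c 0 : ℝ) + 1)| + |((a 0 : ℝ) - b 0) / ((c 0 : ℝ) + 1)| :=
        abs_add_le _ _
    _ ≤ 1 + ((a 0 : ℝ) + b 0) := add_le_add h0 hfrac
    _ = (a 0 : ℝ) + b 0 + 1 := by ring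

/-- Elementary reals are closed under multiplication: read both names at index `M (n+1) - 1`,
`M = a 0 + b 0 + a' 0 + b' 0 + 3 ≥ |x| + |y| + 1`, and multiply the fractions
(Yoshinaga 2008, Prop. 10; Tent–Ziegler 2010, Cor. 4.5). [cite: Yoshinaga2008, Prop. 10] -/
protected theorem mul {x y : ℝ} (hx : IsElementaryReal x) (hy : IsElementaryReal y) :
    IsElementaryReal (x * y) := by
  obtain ⟨a, b, c, ha, hb, hc, h⟩ := hx
  obtain ⟨a', b', c', ha', hb', hc', h'⟩ := hy
  have hxb := abs_le_of_approx h
  have hyb := abs_le_of_approx h'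
  set M : ℕ := a 0 + b 0 + a' 0 + b' 0 + 3 with hM
  have hM1 : 1 ≤ M := by omega
  set φ : ℕ → ℕ := fun n => M * (n + 1) - 1 with hφ
  have eφ : ElementaryRec φ :=
    ElementaryRec.tsub' (ElementaryRec.mul' (ElementaryRec.const M)
      (ElementaryRec.succ' ElementaryRec.id')) (ElementaryRec.const 1)
  have hφ1 : ∀ n, ((φ n : ℕ) : ℝ) + 1 = (M : ℝ) * ((n : ℝ) + 1) := by
    intro n
    have h1 : 1 ≤ M * (n + 1) := Nat.one_le_iff_ne_zero.2 (by positivity)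
    simp only [hφ]
    rw [Nat.cast_sub h1]
    push_cast
    ring
  -- the approximants of `x` and `y` at index `φ n`
  set u : ℕ → ℝ := fun n => ((a (φ n) : ℝ) - b (φ n)) / ((c (φ n) : ℝ) + 1) with hu
  set v : ℕ → ℝ := fun n => ((a' (φ n) : ℝ) - b' (φ n)) / ((c' (φ n) : ℝ) + 1) with hv
  have hux : ∀ n, |x - u n| ≤ 1 / ((M : ℝ) * ((n : ℝ) + 1)) := fun n => by
    rw [← hφ1]; exact h (φ n)
  have hvy : ∀ n, |y - v n| ≤ 1 / ((M : ℝ) * ((n : ℝ) + 1)) := fun n => by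
    rw [← hφ1]; exact h' (φ n)
  refine ⟨fun n => a (φ n) * a' (φ n) + b (φ n) * b' (φ n),
    fun n => a (φ n) * b' (φ n) + b (φ n) * a' (φ n),
    fun n => (c (φ n) + 1) * (c' (φ n) + 1) - 1, ?_, ?_, ?_, fun n => ?_⟩
  · exact ElementaryRec.add' (ElementaryRec.mul' (ha.comp eφ) (ha'.comp eφ))
      (ElementaryRec.mul' (hb.comp eφ) (hb'.comp eφ))
  · exact ElementaryRec.add' (ElementaryRec.mul' (ha.comp eφ) (hb'.comp eφ))
      (ElementaryRec.mul' (hb.comp eφ) (ha'.comp eφ))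
  · exact ElementaryRec.tsub' (ElementaryRec.mul' (ElementaryRec.succ' (hc.comp eφ))
      (ElementaryRec.succ' (hc'.comp eφ))) (ElementaryRec.const 1)
  · have hC : ((((c (φ n) + 1) * (c' (φ n) + 1) - 1 : ℕ) : ℝ) + 1) =
        ((c (φ n) : ℝ) + 1) * ((c' (φ n) : ℝ) + 1) := by
      have h1 : 1 ≤ (c (φ n) + 1) * (c' (φ n) + 1) := Nat.one_le_iff_ne_zero.2 (by positivity)
      rw [Nat.cast_sub h1]
      push_cast
      ring
    have key : (((a (φ n) * a' (φ n) + b (φ n) * b' (φ n) : ℕ) : ℝ) -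
          ((a (φ n) * b' (φ n) + b (φ n) * a' (φ n) : ℕ) : ℝ)) /
          ((((c (φ n) + 1) * (c' (φ n) + 1) - 1 : ℕ) : ℝ) + 1) = u n * v n := by
      rw [hC, hu, hv]
      push_cast
      field_simp
      ring
    rw [key]
    have hMpos : (0 : ℝ) < M := by exact_mod_cast hM1
    have hn : (0 : ℝ) < (n : ℝ) + 1 := by positivity
    have hvb : |v n| ≤ |y| + 1 := by
      have h1 : |v n| ≤ |y| + |y - v n| := by
        calc |v n| = |y - (y - v n)| := by ring_nf
          _ ≤ |y| + |y - v n| := abs_sub _ _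
      have h2 : |y - v n| ≤ 1 := (hvy n).trans (by
        rw [div_le_one (by positivity)]
        have : (1 : ℝ) ≤ M := by exact_mod_cast hM1
        nlinarith)
      linarith
    have hMb : |x| + (|y| + 1) ≤ M := by
      simp only [hM]
      push_cast
      linarith
    calc |x * y - u n * v n| = |x * (y - v n) + (x - u n) * v n| := by ring_nf
      _ ≤ |x * (y - v n)| + |(x - u n) * v n| := abs_add_le _ _
      _ = |x| * |y - v n| + |x - u n| * |v n| := by rw [abs_mul, abs_mul]
      _ ≤ |x| * (1 / ((M : ℝ) * ((n : ℝ) + 1))) + 1 / ((M : ℝ) * ((n : ℝ) + 1)) * (|y| + 1) := by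
          gcongr
          · exact hvy n
          · exact hux n
      _ = (|x| + (|y| + 1)) / ((M : ℝ) * ((n : ℝ) + 1)) := by ring
      _ ≤ (M : ℝ) / ((M : ℝ) * ((n : ℝ) + 1)) := by gcongr
      _ = 1 / ((n : ℝ) + 1) := by field_simp

/-- Natural powers of elementary reals are elementary. [cite: Yoshinaga2008, Prop. 10] -/
protected theorem pow {x : ℝ} (hx : IsElementaryReal x) (k : ℕ) : IsElementaryReal (x ^ k) := by
  induction k with
  | zero => simpa using IsElementaryReal.natCast 1
  | succ k ih => simpa [pow_succ] using ih.mul hx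

/-- The subring of `ℝ` generated by a set of elementary reals consists of elementary reals (the
elementary reals form a subring of `ℝ`; Yoshinaga 2008, Prop. 10: a field).
[cite: Yoshinaga2008, Prop. 10] -/
theorem of_mem_subringClosure {s : Set ℝ} (hs : ∀ y ∈ s, IsElementaryReal y) {x : ℝ}
    (hx : x ∈ Subring.closure s) : IsElementaryReal x := by
  induction hx using Subring.closure_induction with
  | mem y hy => exact hs y hy
  | zero => exact IsElementaryReal.zero
  | one => simpa using IsElementaryReal.natCast 1
  | add y z _ _ hy hz => exact hy.add hz
  | neg y _ hy => exact hy.neg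
  | mul y z _ _ hy hz => exact hy.mul hz

end IsElementaryReal

end Literature.Computability.Complexity
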